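import Mathlib
import Literature.AlgebraicGeometry.Resolution.AffineBlowupAlgebra
import Literature.AlgebraicGeometry.Resolution.BlowupsComposition
import HarnessLib

/-!
# The cover engine: a Rees chart ring `(R[It])_{(Tt·Gt)}` read through a (ramified) cover `β : R → U` is a subalgebra `S ⊆ U`
(crux stmt-ResolutionOfSingularities-15640 `WildQuotients.WildQuotientResolution`, line `Sketch`;
chain w45c RUNG V5 B7/HP₂, res-L1-w45c-plan-1 ORDER 2026-08-27T14:10:40Z (W₂-A) — the generic half
of `JordanFive.exists_chartW₂_away_ringEquiv_fixedTau`; re-cut of res-L1-w45c-stub-1's twist engine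
`JordanFive.exists_ringEquiv_of_twistData_inv` (p530736) for a target that is NOT a localisation of
`R` (a quotient `U = (k[s,Y]⧸(Φ))[1/î]`, image = the fixed subalgebra of a deck involution); written
by res-D-pv-033 AS res-L1-w45c-stub-5. [OURS · L1 W4.5c] — NOT a statement of any manuscript;
replaces the role of no printed item.)

`BlowupExit.exists_ringEquiv_subalgebra_of_coverData`: `R` a commutative `k`-algebra, `I ⊆ R`,
`T, G ∈ I`, `B = (R[It])_{(Tt)}` the Rees chart ring (Literature `reesChartBase`, `reesChart`,
`reesChartEquiv`, `blowupAlgebra`), `θ = (Gt)/(Tt) ∈ B` (Mathlib's `Away.isLocalizationElem`), `C`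
ANY localisation of `B` at `θ` (e.g. `(R[It])_{(Tt·Gt)}` by `Away.isLocalization_mul`). Let
`β : R →ₐ[k] U` be INJECTIVE with `βT·βG` a non-zero-divisor of `U`, and `S ⊆ U` a subalgebra with
`β(R) ⊆ S`, every chart ratio realised in `S` (`∀ x ∈ I, ∃ u ∈ S, u·βT = βx`), `θ⁻¹` realised in `S`
(`∃ v ∈ S, v·βG = βT`), and `S ≤ k[gens]` with a dictionary
`∀ t ∈ gens, ∃ μ e e' F, F ∈ I^μ ∧ t·βT^(μ+e)·βG^e' = βF·βG^e·βT^e'` (i.e. `t = (F/T^μ)·θ^e·θ^{-e'}`).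
Then `C ≃+* S` carrying `r/1 ↦ β r`. Proof: in `L = U[1/(βT·βG)]` the universal maps
`R[1/T] → L ⊇ B`, `C → L` are injective and the image of `C` is `S` (both inclusions on generators).
-/

-- single-problem summit: the doubled namespace component `ResolutionOfSingularities` is forced
set_option linter.dupNamespace false

noncomputable section

open IsLocalization Polynomial HomogeneousLocalization Literature.AlgebraicGeometry.Resolution

namespace Summit.ResolutionOfSingularities.ResolutionOfSingularities.Theorems.WildQuotientResolution.BlowupExit

-- bookkeeping of units in three localisations: individually cheap, long in total
set_option maxHeartbeats 1600000 in
/-- **The cover engine** (see the module docstring): a localisation `C` of the Rees chart ring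
`(R[It])_{(Tt)}` at `θ = (Gt)/(Tt)`, read through an injective `β : R →ₐ[k] U` with `βT·βG` a
non-zero-divisor, is ring-isomorphic to any subalgebra `S ⊆ U` that contains `β(R)`, realises the
chart ratios and `θ⁻¹`, and is generated by elements with a dictionary back to `C`; the isomorphism
carries `r/1 ↦ β r`. [OURS · L1 W4.5c] [folklore] -/
theorem exists_ringEquiv_subalgebra_of_coverData
    {R : Type} [CommRing R] {I : Ideal R} (T : R) (hT : T ∈ I) (G : R) (hG : G ∈ I)
    (C : Type) [CommRing C]
    [Algebra (HomogeneousLocalization.Away (reesGrading I) (reesT T hT)) C]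
    [IsLocalization.Away (HomogeneousLocalization.Away.isLocalizationElem (𝒜 := reesGrading I)
      (reesT_mem T hT) (reesT_mem G hG)) C]
    {k : Type} [CommRing k] [Algebra k R] {U : Type} [CommRing U] [Algebra k U]
    (β : R →ₐ[k] U) (hβ : Function.Injective β) (hnzd : β T * β G ∈ nonZeroDivisors U)
    (S : Subalgebra k U) (hβS : ∀ r, β r ∈ S)
    (hgen : ∀ x ∈ I, ∃ u ∈ S, u * β T = β x)
    (hinv : ∃ v ∈ S, v * β G = β T)
    (gens : Set U) (hS : S ≤ Algebra.adjoin k gens)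
    (hdict : ∀ t ∈ gens, ∃ (μ e e' : ℕ) (F : R), F ∈ I ^ μ ∧
      t * β T ^ (μ + e) * β G ^ e' = β F * β G ^ e * β T ^ e') :
    ∃ eE : C ≃+* ↥S, ∀ r : R,
      ((eE ((algebraMap (HomogeneousLocalization.Away (reesGrading I) (reesT T hT)) C :
          HomogeneousLocalization.Away (reesGrading I) (reesT T hT) →+* C)
        (reesChartBase (I := I) T hT r)) : ↥S) : U) = β r := by
  classical
  -- abbreviations
  set B : Type := HomogeneousLocalization.Away (reesGrading I) (reesT T hT) with hB
  set θ : B := HomogeneousLocalization.Away.isLocalizationElem (𝒜 := reesGrading I)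
      (reesT_mem T hT) (reesT_mem G hG) with hθ
  set φ : R →+* B := reesChartBase T hT with hφ
  -- the big ring `L = U[1/(βT·βG)]`
  set L : Type := Localization.Away (β T * β G) with hL
  set j : U →+* L := algebraMap U L with hj
  have hjinj : Function.Injective j :=
    IsLocalization.injective L (M := Submonoid.powers (β T * β G)) (Submonoid.powers_le.2 hnzd)
  set w : L := IsLocalization.Away.invSelf (β T * β G) with hw
  have hw1 : j (β T) * j (β G) * w = 1 := by
    have h := IsLocalization.Away.mul_invSelf (S := L) (β T * β G)
    rw [map_mul] at h
    exact h
  -- explicit inverses of `j (β T)`, `j (β G)`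
  set iT : L := j (β G) * w with hiT
  set iG : L := j (β T) * w with hiG
  have hiT1 : j (β T) * iT = 1 := by rw [hiT, ← mul_assoc, hw1]
  have hiG1 : j (β G) * iG = 1 := by rw [hiG, ← mul_assoc, mul_comm (j (β G)), hw1]
  have huT : IsUnit (j (β T)) := IsUnit.of_mul_eq_one _ hiT1
  have huG : IsUnit (j (β G)) := IsUnit.of_mul_eq_one _ hiG1
  let jₐ : U →ₐ[k] L := IsScalarTower.toAlgHom k U L
  have hjₐ : ∀ u, jₐ u = j u := fun u => rfl
  have hjₐinj : Function.Injective jₐ := hjinj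
  -- `h₀ : R[1/T] → L` extending `j ∘ β`
  set L₁ : Type := Localization.Away T with hL₁
  set ι₁ : R →+* L₁ := algebraMap R L₁ with hι₁
  have hgT : IsUnit ((j.comp (β : R →+* U)) T) := huT
  let h₀ : L₁ →+* L := IsLocalization.Away.lift T hgT
  have hh₀ι : ∀ x, h₀ (ι₁ x) = j (β x) := fun x => IsLocalization.Away.lift_eq T hgT x
  have hh₀inv : h₀ (IsLocalization.Away.invSelf T) = iT := by
    have h1 : h₀ (ι₁ T * IsLocalization.Away.invSelf T) = 1 := by
      rw [IsLocalization.Away.mul_invSelf, map_one]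
    rw [map_mul h₀, hh₀ι] at h1
    exact (left_inv_eq_right_inv (by rw [mul_comm]; exact h1) hiT1)
  have hh₀inj : Function.Injective h₀ := by
    rw [injective_iff_map_eq_zero]
    intro z hz
    obtain ⟨⟨x, s⟩, hzr⟩ := IsLocalization.surj (Submonoid.powers T) z
    change z * ι₁ s = ι₁ x at hzr
    have hx : β x = 0 := by
      apply hjinj
      rw [map_zero, ← hh₀ι, ← hzr, map_mul, hz, zero_mul]
    have hx0 : x = 0 := hβ (by rw [hx, map_zero])
    rw [hx0, map_zero] at hzr
    exact (IsLocalization.map_units L₁ s).mul_left_eq_zero.mp hzr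
  -- `Φ₀ : B → L`
  let Φ₀ : B →+* L := h₀.comp (reesChart T hT)
  have hΦ₀ : ∀ x, Φ₀ x = h₀ (reesChart T hT x) := fun x => rfl
  have hΦ₀inj : Function.Injective Φ₀ := hh₀inj.comp (reesChart_injective T hT)
  have hΦ₀base : ∀ r, Φ₀ (φ r) = j (β r) := fun r => by
    rw [hΦ₀, hφ, reesChart_reesChartBase, ← hι₁, hh₀ι]
  -- `θ ↦ βG / βT`
  have hΦ₀θ : Φ₀ θ = j (β G) * iT := by
    have h1 : Φ₀ (φ G) = Φ₀ θ * Φ₀ (φ T) := by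
      rw [hφ, hθ, reesChartBase_eq_isLocalizationElem_mul T hT G hG, map_mul]
    rw [hΦ₀base, hΦ₀base] at h1
    calc Φ₀ θ = Φ₀ θ * (j (β T) * iT) := by rw [hiT1, mul_one]
      _ = (Φ₀ θ * j (β T)) * iT := by ring
      _ = j (β G) * iT := by rw [← h1]
  have hθu : IsUnit (Φ₀ θ) := by
    rw [hΦ₀θ]
    exact huG.mul (IsUnit.of_mul_eq_one _ (by rw [mul_comm]; exact hiT1))
  -- `Φ : C → L`
  let Φ : C →+* L := IsLocalization.Away.lift θ hθu
  have hΦalg : ∀ x, Φ ((algebraMap B C : B →+* C) x) = Φ₀ x := fun x =>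
    IsLocalization.Away.lift_eq θ hθu x
  have hΦinvθ : Φ (IsLocalization.Away.invSelf θ) = j (β T) * iG := by
    have h := congrArg Φ (IsLocalization.Away.mul_invSelf (S := C) θ)
    rw [map_mul Φ, map_one Φ, hΦalg, hΦ₀θ] at h
    have h2 : j (β G) * iT * (j (β T) * iG) = 1 := by
      calc _ = (j (β G) * iG) * (j (β T) * iT) := by ring
        _ = 1 := by rw [hiG1, hiT1, mul_one]
    exact left_inv_eq_right_inv (by rw [mul_comm]; exact h) h2
  have hΦinj : Function.Injective Φ := by
    rw [injective_iff_map_eq_zero]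
    intro z hz
    obtain ⟨⟨x, s⟩, hzr⟩ := IsLocalization.surj (Submonoid.powers θ) z
    change z * (algebraMap B C : B →+* C) s = (algebraMap B C : B →+* C) x at hzr
    have hx : Φ₀ x = 0 := by rw [← hΦalg, ← hzr, map_mul Φ, hz, zero_mul]
    have hx0 : x = 0 := hΦ₀inj (by rw [hx, map_zero])
    rw [hx0, map_zero] at hzr
    exact (IsLocalization.map_units C s).mul_left_eq_zero.mp hzr
  -- `θ⁻¹` is realised in `S`
  obtain ⟨v, hvS, hv⟩ := hinv
  have hjv : j v = j (β T) * iG := by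
    have h := congrArg j hv
    rw [map_mul] at h
    calc j v = j v * (j (β G) * iG) := by rw [hiG1, mul_one]
      _ = (j v * j (β G)) * iG := by ring
      _ = j (β T) * iG := by rw [h]
  have hmapj : ∀ u, u ∈ S → j u ∈ Subalgebra.map jₐ S := fun u hu =>
    Subalgebra.mem_map.mpr ⟨u, hu, rfl⟩
  -- (⊆) the image of the affine blow-up algebra lies in `j(S)`
  have hBlsub : ∀ y, y ∈ blowupAlgebra I T → h₀ y ∈ Subalgebra.map jₐ S := by
    intro y hy
    refine Algebra.adjoin_induction (fun y hy => ?_) (fun x => ?_) (fun _ _ _ _ hx hy => ?_)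
      (fun _ _ _ _ hx hy => ?_) hy
    · obtain ⟨x, hx, rfl⟩ := hy
      obtain ⟨u, huS, hu⟩ := hgen x hx
      have key : h₀ (ι₁ x * IsLocalization.Away.invSelf T) = j u := by
        rw [map_mul h₀, hh₀ι, hh₀inv]
        have h := congrArg j hu
        rw [map_mul] at h
        calc j (β x) * iT = (j u * j (β T)) * iT := by rw [h]
          _ = j u * (j (β T) * iT) := by ring
          _ = j u := by rw [hiT1, mul_one]
      rw [key]
      exact hmapj u huS
    · change h₀ (ι₁ x) ∈ _
      rw [hh₀ι]
      exact hmapj _ (hβS x)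
    · rw [map_add h₀]; exact Subalgebra.add_mem _ hx hy
    · rw [map_mul h₀]; exact Subalgebra.mul_mem _ hx hy
  have hsub : ∀ z : C, Φ z ∈ Subalgebra.map jₐ S := by
    intro z
    obtain ⟨⟨x, s⟩, hzr⟩ := IsLocalization.surj (Submonoid.powers θ) z
    obtain ⟨m', hm⟩ := s.2
    change z * (algebraMap B C : B →+* C) s = (algebraMap B C : B →+* C) x at hzr
    have hz : Φ z = Φ₀ x * Φ (IsLocalization.Away.invSelf θ) ^ m' := by
      have h1 := congrArg Φ hzr
      rw [map_mul Φ, hΦalg, hΦalg, ← hm, map_pow Φ₀] at h1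
      have h2 : Φ₀ θ * Φ (IsLocalization.Away.invSelf θ) = 1 := by
        rw [← hΦalg, ← map_mul Φ, IsLocalization.Away.mul_invSelf, map_one]
      calc Φ z = Φ z * (Φ₀ θ * Φ (IsLocalization.Away.invSelf θ)) ^ m' := by
            rw [h2, one_pow, mul_one]
        _ = Φ z * Φ₀ θ ^ m' * Φ (IsLocalization.Away.invSelf θ) ^ m' := by ring
        _ = Φ₀ x * Φ (IsLocalization.Away.invSelf θ) ^ m' := by rw [h1]
    rw [hz, hΦinvθ, ← hjv]
    refine Subalgebra.mul_mem _ ?_ (Subalgebra.pow_mem _ (hmapj _ hvS) m')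
    have hxBl : reesChart T hT x ∈ blowupAlgebra I T := by
      have : reesChart T hT x ∈ Set.range (reesChart T hT) := ⟨x, rfl⟩
      rwa [range_reesChart T hT] at this
    exact hBlsub _ hxBl
  -- elements of `C` from the affine blow-up algebra, and their images
  have hcOf : ∀ (y : L₁) (hy : y ∈ blowupAlgebra I T),
      Φ ((algebraMap B C : B →+* C) ((reesChartEquiv T hT).symm ⟨y, hy⟩)) = h₀ y := by
    intro y hy
    rw [hΦalg, hΦ₀, ← coe_reesChartEquiv, RingEquiv.apply_symm_apply]
  have hmemBl : ∀ (μ : ℕ) (F : R), F ∈ I ^ μ →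
      ι₁ F * IsLocalization.Away.invSelf T ^ μ ∈ blowupAlgebra I T := fun μ F hF =>
    algebraMap_mul_invSelf_pow_mem_blowupAlgebra T μ hF
  -- the dictionary: `t·βT^(μ+e)·βG^e' = βF·βG^e·βT^e'` gives `j t = Φ (F/T^μ · θ^e · (θ⁻¹)^e')`
  have hdictC : ∀ (μ e e' : ℕ) (F : R) (t : U) (hF : F ∈ I ^ μ),
      t * β T ^ (μ + e) * β G ^ e' = β F * β G ^ e * β T ^ e' →
      Φ ((algebraMap B C : B →+* C) ((reesChartEquiv T hT).symm ⟨_, hmemBl μ F hF⟩) *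
        (algebraMap B C : B →+* C) θ ^ e * IsLocalization.Away.invSelf θ ^ e') = j t := by
    intro μ e e' F t hF hrel
    rw [map_mul Φ, map_mul Φ, map_pow Φ, map_pow Φ, hcOf, map_mul h₀, map_pow h₀, hh₀ι, hh₀inv,
      hΦalg, hΦ₀θ, hΦinvθ]
    have h1 : j t * j (β T) ^ (μ + e) * j (β G) ^ e' = j (β F) * j (β G) ^ e * j (β T) ^ e' := by
      have h := congrArg j hrel
      simpa only [map_mul, map_pow] using h
    have hTe : ∀ n : ℕ, j (β T) ^ n * iT ^ n = 1 := fun n => by rw [← mul_pow, hiT1, one_pow]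
    have hGe : ∀ n : ℕ, j (β G) ^ n * iG ^ n = 1 := fun n => by rw [← mul_pow, hiG1, one_pow]
    symm
    calc j t = j t * (j (β T) ^ (μ + e) * iT ^ (μ + e)) * (j (β G) ^ e' * iG ^ e') := by
          rw [hTe, hGe, mul_one, mul_one]
      _ = (j t * j (β T) ^ (μ + e) * j (β G) ^ e') * iT ^ (μ + e) * iG ^ e' := by ring
      _ = (j (β F) * j (β G) ^ e * j (β T) ^ e') * iT ^ (μ + e) * iG ^ e' := by rw [h1]
      _ = j (β F) * iT ^ μ * (j (β G) * iT) ^ e * (j (β T) * iG) ^ e' := by ring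
  -- (⊇) every element of `S` is hit
  have hsup : ∀ u, u ∈ S → ∃ z : C, Φ z = j u := by
    intro u hu
    have hu' : u ∈ Algebra.adjoin k gens := hS hu
    refine Algebra.adjoin_induction (fun y hy => ?_) (fun c => ?_) (fun _ _ _ _ hx hy => ?_)
      (fun _ _ _ _ hx hy => ?_) hu'
    · obtain ⟨μ, e, e', F, hF, hrel⟩ := hdict y hy
      exact ⟨_, hdictC μ e e' F y hF hrel⟩
    · refine ⟨(algebraMap B C : B →+* C) (φ (algebraMap k R c)), ?_⟩
      rw [hΦalg, hΦ₀base, AlgHom.commutes, ← hjₐ, AlgHom.commutes]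
    · obtain ⟨z₁, h₁⟩ := hx
      obtain ⟨z₂, h₂⟩ := hy
      exact ⟨z₁ + z₂, by rw [map_add Φ, h₁, h₂, map_add j]⟩
    · obtain ⟨z₁, h₁⟩ := hx
      obtain ⟨z₂, h₂⟩ := hy
      exact ⟨z₁ * z₂, by rw [map_mul Φ, h₁, h₂, map_mul j]⟩
  -- the isomorphism `C ≃ S.map jₐ ≃ S`
  let Φ' : C →+* ↥(Subalgebra.map jₐ S) := Φ.codRestrict (Subalgebra.map jₐ S).toSubring fun z => hsub z
  have hΦ' : Function.Bijective Φ' := by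
    refine ⟨fun z₁ z₂ h => hΦinj (congrArg Subtype.val h), fun y => ?_⟩
    obtain ⟨u, hu, huy⟩ := Subalgebra.mem_map.mp y.2
    obtain ⟨z, hz⟩ := hsup u hu
    exact ⟨z, Subtype.ext (by rw [← huy]; exact hz)⟩
  let e₁ : C ≃+* ↥(Subalgebra.map jₐ S) := RingEquiv.ofBijective Φ' hΦ'
  let e₂ : ↥(Subalgebra.map jₐ S) ≃+* ↥S := (Subalgebra.equivMapOfInjective S jₐ hjₐinj).symm.toRingEquiv
  have he : ∀ (z : C) (u : U) (hu : u ∈ S), Φ z = j u → ((e₁.trans e₂ z : S) : U) = u := by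
    intro z u hu hzu
    have hu' : j u ∈ Subalgebra.map jₐ S := hmapj u hu
    have h1 : e₁ z = ⟨j u, hu'⟩ := Subtype.ext hzu
    have h2 : (Subalgebra.equivMapOfInjective S jₐ hjₐinj) ⟨u, hu⟩ = ⟨j u, hu'⟩ :=
      Subtype.ext (Subalgebra.coe_equivMapOfInjective_apply S jₐ hjₐinj ⟨u, hu⟩)
    have h3 : e₂ ⟨j u, hu'⟩ = ⟨u, hu⟩ := by
      change (Subalgebra.equivMapOfInjective S jₐ hjₐinj).symm ⟨j u, hu'⟩ = ⟨u, hu⟩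
      rw [AlgEquiv.symm_apply_eq, h2]
    rw [RingEquiv.trans_apply, h1, h3]
  refine ⟨e₁.trans e₂, fun r => ?_⟩
  exact he _ _ (hβS r) (by rw [hΦalg, hΦ₀base])

end Summit.ResolutionOfSingularities.ResolutionOfSingularities.Theorems.WildQuotientResolution.BlowupExit

end
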